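import Mathlib
import Summits.Ventures.PercRepro2.HCov
import Summits.Ventures.PercRepro2.RECMReduction
import Summits.Ventures.PercRepro2.CCWReduced
import Summits.Ventures.PercRepro2.CutVertexPaths
import Summits.Ventures.PercRepro2.GcSkelRules
import Summits.Ventures.PercRepro2.GcSkelReduction
import Summits.Ventures.PercRepro2.GcSkelReductionC
import Summits.Ventures.PercRepro2.GcSkelReductionI
import Summits.Ventures.PercRepro2.GcBlockConn
import Summits.Ventures.PercRepro2.GcBlock
import Summits.Ventures.PercRepro2.GcSkelReductionT

/-!
# The residual with its minimal clause list (blind cell PercRepro2, typer-1 g54)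

With the block collapse in the calculus, five clauses of `WReducedT` are consequences of the
others: the unmarked-degree clause (an unmarked leaf or series vertex is a one-vertex block), the
pendant-root clauses `leaf_a1` / `leaf_a2` (their hypothesis `nonLoopDeg = 1` is excluded by
`deg_a1` / `deg_a2`), and the cut-vertex clauses `prune` / `oneFar` (a mark-free side of a cut
vertex `v` is a block with both terminals `v`; a side with one far mark `w` is a block with
terminals `v, w` once `w` is removed — two non-loop edges on the side give a collapsible block,
or two parallel `{w, v}` edges).

**`WReducedMin`** lists what remains: simple · no collapsible block · `o, b, a₁, a₂` not leaves ·
a pendant `a₃` at an unmarked vertex · no `2 + 3` split of the marks at a cut vertex · the class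
clauses (¬R, ¬R₃, no root-only pocket, (SEP-2), (SEP-3) both mirrors, no necklace, no
block-substitution class, no certified seven-skeleton in either root order) · none of
`a₁, a₂, o, b` isolated. **`wredT_iff_wredMin`**: `WReducedT ↔ WReducedMin`.

* `hasBlock_of_unmarked_leaf` / `hasBlock_of_unmarked_series` — one-vertex blocks;
* `isBlock_left_of_cutVertex` — the left side of a cut vertex is a block with terminals `v, v`;
  `hasBlock_of_prune` — a non-loop left edge of a mark-free side;
* `isBlock_left_erase_of_cutVertex` — the left side minus a vertex `w` is a block with terminals
  `v, w`; `hasBlock_of_oneFar` — two non-loop left edges with a single far mark `w` on a simple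
  graph.
-/

namespace Summit.Ventures.PercRepro2

open CovForm RECM CutVertexM9 SepPair

namespace WRed

/-! ## One-vertex blocks -/

section OneVertex

variable {V : Type*} {E : Type*} [Fintype E] [DecidableEq E] [DecidableEq V]

omit [Fintype E] [DecidableEq E] [DecidableEq V] in
/-- A loop at `y` has both ends at `y`. -/
lemma ends_eq_of_isDiag_of_mem {ends : E → Sym2 V} {g : E} {y x z : V} (hd : (ends g).IsDiag)
    (hy : y ∈ ends g) (h : ends g = s(x, z)) : x = y ∧ z = y := by
  rw [h, Sym2.mk_isDiag_iff] at hd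
  subst hd
  rw [h, Sym2.mem_iff] at hy
  rcases hy with rfl | rfl <;> exact ⟨rfl, rfl⟩

/-- **An unmarked leaf is a collapsible block**: `W = {y}`, both terminals its neighbour. -/
lemma hasBlock_of_unmarked_leaf {ends : E → Sym2 V} {o a₁ a₂ a₃ b y : V}
    (hy : Unmarked o a₁ a₂ a₃ b y) (h1 : nonLoopDeg ends y = 1) :
    Block.HasBlock ends o a₁ a₂ a₃ b := by
  obtain ⟨e, x, he, hxy, hleaf⟩ := leaf_of_nonLoopDeg_one h1
  refine ⟨{y}, x, x, ⟨by simpa using hxy, by simpa using hxy, fun g hg x' z' hends => ?_⟩,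
    fun z hz => by rw [Set.mem_singleton_iff] at hz; exact hz ▸ hy,
    Or.inr ⟨rfl, e, mem_touches_of_ends he (Or.inr (Set.mem_singleton y)),
      by rw [he, Sym2.mk_isDiag_iff]; exact hxy⟩⟩
  -- an edge touching `{y}`: the leaf edge or a loop at `y`
  obtain ⟨w, hw, w', hw'⟩ := hg
  rw [Set.mem_singleton_iff] at hw
  subst hw
  have hyg : w ∈ ends g := by rw [hw']; exact Sym2.mem_mk_left _ _
  by_cases hge : g = e
  · subst hge
    rw [he, Sym2.eq_iff] at hends
    rcases hends with ⟨rfl, rfl⟩ | ⟨rfl, rfl⟩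
    · exact ⟨Or.inr (Or.inl rfl), Or.inl (Set.mem_singleton _)⟩
    · exact ⟨Or.inl (Set.mem_singleton _), Or.inr (Or.inl rfl)⟩
  · obtain ⟨rfl, rfl⟩ := ends_eq_of_isDiag_of_mem (hleaf g hge hyg) hyg hends
    exact ⟨Or.inl (Set.mem_singleton _), Or.inl (Set.mem_singleton _)⟩

/-- **An unmarked series vertex is a collapsible block**: `W = {y}`, terminals its two
neighbours. -/
lemma hasBlock_of_unmarked_series {ends : E → Sym2 V} {o a₁ a₂ a₃ b y : V}
    (hy : Unmarked o a₁ a₂ a₃ b y) (h2 : nonLoopDeg ends y = 2) :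
    Block.HasBlock ends o a₁ a₂ a₃ b := by
  obtain ⟨e, f, x, w, hef, he, hf, hxy, hyw, hdeg⟩ := series_of_nonLoopDeg_two h2
  refine ⟨{y}, x, w, ⟨by simpa using hxy, by simpa using hyw.symm,
    fun g hg x' z' hends => ?_⟩, fun z hz => by rw [Set.mem_singleton_iff] at hz; exact hz ▸ hy,
    Or.inl ⟨e, f, hef, mem_touches_of_ends he (Or.inr (Set.mem_singleton y)),
      mem_touches_of_ends hf (Or.inl (Set.mem_singleton y)),
      by rw [he, Sym2.mk_isDiag_iff]; exact hxy, by rw [hf, Sym2.mk_isDiag_iff]; exact hyw⟩⟩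
  -- an edge touching `{y}`: one of the two series edges or a loop at `y`
  obtain ⟨v, hv, v', hv'⟩ := hg
  rw [Set.mem_singleton_iff] at hv
  subst hv
  have hyg : v ∈ ends g := by rw [hv']; exact Sym2.mem_mk_left _ _
  by_cases hge : g = e
  · subst hge
    rw [he, Sym2.eq_iff] at hends
    rcases hends with ⟨rfl, rfl⟩ | ⟨rfl, rfl⟩
    · exact ⟨Or.inr (Or.inl rfl), Or.inl (Set.mem_singleton _)⟩
    · exact ⟨Or.inl (Set.mem_singleton _), Or.inr (Or.inl rfl)⟩
  by_cases hgf : g = f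
  · subst hgf
    rw [hf, Sym2.eq_iff] at hends
    rcases hends with ⟨rfl, rfl⟩ | ⟨rfl, rfl⟩
    · exact ⟨Or.inl (Set.mem_singleton _), Or.inr (Or.inr rfl)⟩
    · exact ⟨Or.inr (Or.inr rfl), Or.inl (Set.mem_singleton _)⟩
  obtain ⟨rfl, rfl⟩ := ends_eq_of_isDiag_of_mem (hdeg g hge hgf hyg) hyg hends
  exact ⟨Or.inl (Set.mem_singleton _), Or.inl (Set.mem_singleton _)⟩

end OneVertex

/-! ## The sides of a cut vertex are blocks -/

section CutSides

variable {V : Type*} {E : Type*}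

/-- An edge touching the left side of a cut vertex is a left edge. -/
lemma side_eq_true_of_mem_touches_left {ends : E → Sym2 V} {side : E → Bool} {L : Set V} {v : V}
    {Rt : Set V} (hcut : CutVertex ends side L v Rt) {e : E} (he : e ∈ touches ends L) :
    side e = true := by
  obtain ⟨x, hx, y, hxy⟩ := he
  by_contra hs
  rw [Bool.not_eq_true] at hs
  rcases hcut.right e hs x (by rw [hxy]; exact Sym2.mem_mk_left _ _) with hR | rfl
  · exact hcut.disj x hx hR
  · exact hcut.vL hx

/-- **The left side of a cut vertex is a block with both terminals the cut vertex.** -/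
lemma isBlock_left_of_cutVertex {ends : E → Sym2 V} {side : E → Bool} {L : Set V} {v : V}
    {Rt : Set V} (hcut : CutVertex ends side L v Rt) : Block.IsBlock ends L v v := by
  refine ⟨hcut.vL, hcut.vL, fun e he x y hends => ?_⟩
  have hs := side_eq_true_of_mem_touches_left hcut he
  have hx := hcut.left e hs x (by rw [hends]; exact Sym2.mem_mk_left _ _)
  have hy := hcut.left e hs y (by rw [hends]; exact Sym2.mem_mk_right _ _)
  exact ⟨hx.imp_right Or.inl, hy.imp_right Or.inl⟩

/-- **The left side of a cut vertex minus a vertex `w` is a block with terminals `v, w`.** -/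
lemma isBlock_left_erase_of_cutVertex {ends : E → Sym2 V} {side : E → Bool} {L : Set V} {v : V}
    {Rt : Set V} (hcut : CutVertex ends side L v Rt) (w : V) :
    Block.IsBlock ends (L \ {w}) v w := by
  refine ⟨fun h => hcut.vL h.1, fun h => h.2 rfl, fun e he x y hends => ?_⟩
  have heL : e ∈ touches ends L := by
    obtain ⟨x', hx', y', h'⟩ := he
    exact ⟨x', hx'.1, y', h'⟩
  have hs := side_eq_true_of_mem_touches_left hcut heL
  have key : ∀ z, z ∈ L ∨ z = v → z ∈ L \ {w} ∨ z = v ∨ z = w := by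
    intro z hz
    rcases hz with hz | rfl
    · by_cases hzw : z = w
      · exact Or.inr (Or.inr hzw)
      · exact Or.inl ⟨hz, hzw⟩
    · exact Or.inr (Or.inl rfl)
  exact ⟨key x (hcut.left e hs x (by rw [hends]; exact Sym2.mem_mk_left _ _)),
    key y (hcut.left e hs y (by rw [hends]; exact Sym2.mem_mk_right _ _))⟩

/-- A non-loop left edge of a cut vertex touches the left side. -/
lemma mem_touches_left_of_side {ends : E → Sym2 V} {side : E → Bool} {L : Set V} {v : V}
    {Rt : Set V} (hcut : CutVertex ends side L v Rt) {g : E} (hg : side g = true)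
    (hd : ¬ (ends g).IsDiag) : g ∈ touches ends L := by
  obtain ⟨x, y, hxy⟩ : ∃ x y, ends g = s(x, y) :=
    (Sym2.exists (f := fun t => ends g = t)).1 ⟨ends g, rfl⟩
  have hx := hcut.left g hg x (by rw [hxy]; exact Sym2.mem_mk_left _ _)
  have hy := hcut.left g hg y (by rw [hxy]; exact Sym2.mem_mk_right _ _)
  rcases hx with hx | rfl
  · exact ⟨x, hx, y, hxy⟩
  · rcases hy with hy | rfl
    · exact ⟨y, hy, x, by rw [hxy, Sym2.eq_swap]⟩
    · rw [hxy, Sym2.mk_isDiag_iff] at hd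
      exact absurd rfl hd

/-- A mark-free left side: no mark lies in `L` when every mark is in `Rt ∪ {v}`. -/
lemma unmarked_of_mem_left {ends : E → Sym2 V} {side : E → Bool} {L : Set V} {v : V} {Rt : Set V}
    (hcut : CutVertex ends side L v Rt) {o a₁ a₂ a₃ b : V}
    (hM : ∀ m ∈ ({o, a₁, a₂, a₃, b} : Set V), m ∈ Rt ∨ m = v) {y : V} (hy : y ∈ L) :
    Unmarked o a₁ a₂ a₃ b y := by
  have key : ∀ m ∈ ({o, a₁, a₂, a₃, b} : Set V), y ≠ m := by
    intro m hm hym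
    subst hym
    rcases hM y hm with hR | rfl
    · exact hcut.disj y hy hR
    · exact hcut.vL hy
  exact ⟨key o (by simp), key a₁ (by simp), key a₂ (by simp), key a₃ (by simp), key b (by simp)⟩

/-- **Pruning is a block collapse**: a mark-free left side with a non-loop left edge is a
collapsible block. -/
lemma hasBlock_of_prune {ends : E → Sym2 V} {side : E → Bool} {L : Set V} {v : V} {Rt : Set V}
    (hcut : CutVertex ends side L v Rt) {o a₁ a₂ a₃ b : V}
    (hM : ∀ m ∈ ({o, a₁, a₂, a₃, b} : Set V), m ∈ Rt ∨ m = v) {g : E} (hg : side g = true)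
    (hd : ¬ (ends g).IsDiag) : Block.HasBlock ends o a₁ a₂ a₃ b :=
  ⟨L, v, v, isBlock_left_of_cutVertex hcut, fun _ hy => unmarked_of_mem_left hcut hM hy,
    Or.inr ⟨rfl, g, mem_touches_left_of_side hcut hg hd, hd⟩⟩

end CutSides

/-! ## One far mark -/

section OneFar

variable {V : Type*} {E : Type*} [Fintype E] [DecidableEq E] [DecidableEq V]

omit [DecidableEq E] in
/-- Two distinct non-loop edges at a vertex of a mark-free block give a collapsible block. -/
lemma hasBlock_of_two_at {ends : E → Sym2 V} {o a₁ a₂ a₃ b : V} {W : Set V} {u v : V}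
    (hB : Block.IsBlock ends W u v) (hW : ∀ y ∈ W, Unmarked o a₁ a₂ a₃ b y) {y : V} (hy : y ∈ W)
    (h2 : 1 < nonLoopDeg ends y) : Block.HasBlock ends o a₁ a₂ a₃ b := by
  obtain ⟨g₁, hg₁, g₂, hg₂, hne⟩ := Finset.one_lt_card.1 h2
  exact ⟨W, u, v, hB, hW, Or.inl ⟨g₁, g₂, hne, mem_touches_of_mem_edgesAt hy hg₁,
    mem_touches_of_mem_edgesAt hy hg₂, (mem_edgesAt.1 hg₁).2, (mem_edgesAt.1 hg₂).2⟩⟩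

omit [DecidableEq E] in
/-- A non-loop edge with an end `y` gives `nonLoopDeg ends y ≥ 1`. -/
lemma one_le_nonLoopDeg_of_mem {ends : E → Sym2 V} {g : E} {y : V} (hy : y ∈ ends g)
    (hd : ¬ (ends g).IsDiag) : 1 ≤ nonLoopDeg ends y :=
  Finset.card_pos.mpr ⟨g, mem_edgesAt.mpr ⟨hy, hd⟩⟩

/-- **One far mark is a block collapse**: on a simple graph, a left side with a single far mark
`w` and two distinct non-loop left edges has a collapsible block. -/
lemma hasBlock_of_oneFar {ends : E → Sym2 V} (hsimp : Simple ends) {side : E → Bool} {L : Set V}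
    {v : V} {Rt : Set V} (hcut : CutVertex ends side L v Rt) {o a₁ a₂ a₃ b w : V} (hw : w ∈ L)
    (hM : ∀ m ∈ ({o, a₁, a₂, a₃, b} : Set V), m = w ∨ m ∈ Rt ∨ m = v) {g₁ g₂ : E}
    (hne : g₁ ≠ g₂) (hs₁ : side g₁ = true) (hd₁ : ¬ (ends g₁).IsDiag) (hs₂ : side g₂ = true)
    (hd₂ : ¬ (ends g₂).IsDiag) : Block.HasBlock ends o a₁ a₂ a₃ b := by
  have hB := isBlock_left_erase_of_cutVertex hcut (w := w)
  have hfree : ∀ y ∈ L \ {w}, Unmarked o a₁ a₂ a₃ b y := by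
    intro y hy
    have key : ∀ m ∈ ({o, a₁, a₂, a₃, b} : Set V), y ≠ m := by
      intro m hm hym
      subst hym
      rcases hM y hm with rfl | hR | rfl
      · exact hy.2 rfl
      · exact hcut.disj y hy.1 hR
      · exact hcut.vL hy.1
    exact ⟨key o (by simp), key a₁ (by simp), key a₂ (by simp), key a₃ (by simp),
      key b (by simp)⟩
  -- a non-loop left edge either touches `L \ {w}` or is a `{w, v}` edge
  have hclass : ∀ g, side g = true → ¬ (ends g).IsDiag →
      (∃ y ∈ L \ {w}, y ∈ ends g) ∨ ends g = s(w, v) := by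
    intro g hg hd
    obtain ⟨x, y, hxy⟩ : ∃ x y, ends g = s(x, y) :=
      (Sym2.exists (f := fun t => ends g = t)).1 ⟨ends g, rfl⟩
    have hx := hcut.left g hg x (by rw [hxy]; exact Sym2.mem_mk_left _ _)
    have hy := hcut.left g hg y (by rw [hxy]; exact Sym2.mem_mk_right _ _)
    by_cases hxw : x ∈ L \ {w}
    · exact Or.inl ⟨x, hxw, by rw [hxy]; exact Sym2.mem_mk_left _ _⟩
    by_cases hyw : y ∈ L \ {w}
    · exact Or.inl ⟨y, hyw, by rw [hxy]; exact Sym2.mem_mk_right _ _⟩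
    right
    have hx' : x = w ∨ x = v := by
      rcases hx with hx | rfl
      · exact Or.inl (by_contra fun h => hxw ⟨hx, h⟩)
      · exact Or.inr rfl
    have hy' : y = w ∨ y = v := by
      rcases hy with hy | rfl
      · exact Or.inl (by_contra fun h => hyw ⟨hy, h⟩)
      · exact Or.inr rfl
    have hne' : x ≠ y := by
      intro h
      rw [hxy, Sym2.mk_isDiag_iff] at hd
      exact hd h
    rcases hx' with rfl | rfl <;> rcases hy' with rfl | rfl
    · exact absurd rfl hne'
    · exact hxy
    · rw [hxy, Sym2.eq_swap]
    · exact absurd rfl hne'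
  -- a vertex of the block with a non-loop edge: two edges there, or an unmarked leaf
  have hvertex : ∀ g, side g = true → ¬ (ends g).IsDiag → (∃ y ∈ L \ {w}, y ∈ ends g) →
      Block.HasBlock ends o a₁ a₂ a₃ b := by
    rintro g hg hd ⟨y, hy, hyg⟩
    rcases Nat.lt_or_ge 1 (nonLoopDeg ends y) with h2 | h1
    · exact hasBlock_of_two_at hB hfree hy h2
    · have : nonLoopDeg ends y = 1 := le_antisymm h1 (one_le_nonLoopDeg_of_mem hyg hd)
      exact hasBlock_of_unmarked_leaf (hfree y hy) this
  rcases hclass g₁ hs₁ hd₁ with h₁ | h₁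
  · exact hvertex g₁ hs₁ hd₁ h₁
  rcases hclass g₂ hs₂ hd₂ with h₂ | h₂
  · exact hvertex g₂ hs₂ hd₂ h₂
  -- two parallel `{w, v}` edges: not simple
  exact absurd (h₁.trans h₂.symm) (hsimp g₁ g₂ hne hd₁)

end OneFar

/-! ## The minimal clause list -/

section ClassMin

variable {V : Type*} {E : Type*} [Fintype E] [DecidableEq E] [DecidableEq V]

/-- **The residual with its minimal clause list**: simple, no collapsible block, `o, b, a₁, a₂`
not leaves, a pendant `a₃` at an unmarked vertex, no `2 + 3` split of the marks at a cut vertex,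
the class clauses, and none of `a₁, a₂, o, b` isolated. -/
structure WReducedMin (ends : E → Sym2 V) (o a₁ a₂ a₃ b : V) : Prop where
  /-- no two parallel non-loop edges -/
  simple : Simple ends
  /-- no mark-free two-terminal block the collapse shrinks -/
  noBlock : ¬ Block.HasBlock ends o a₁ a₂ a₃ b
  /-- `o` is not a leaf -/
  deg_o : nonLoopDeg ends o ≠ 1
  /-- `b` is not a leaf -/
  deg_b : nonLoopDeg ends b ≠ 1
  /-- `a₁` is not a leaf -/
  deg_a1 : nonLoopDeg ends a₁ ≠ 1
  /-- `a₂` is not a leaf -/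
  deg_a2 : nonLoopDeg ends a₂ ≠ 1
  /-- a pendant `a₃` hangs at an unmarked vertex -/
  leaf_a3 : ∀ (e : E) (x : V), ends e = s(x, a₃) → x ≠ a₃ → nonLoopDeg ends a₃ = 1 →
    Unmarked o a₁ a₂ a₃ b x
  /-- no `2 + 3` split of the marks at a cut vertex -/
  twoThree : ∀ (side : E → Bool) (L : Set V) (v : V) (Rt : Set V),
    CutVertex ends side L v Rt → ¬ TwoThree L v Rt o a₁ a₂ a₃ b
  /-- not class R -/
  notR : ¬ RootsToMarks ends o a₁ a₂ a₃ b
  /-- not class R₃ -/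
  notR3 : ¬ A3RECM.A3ToMarks ends o a₁ a₂ a₃ b
  /-- no root-only pocket around `a₃` -/
  noPocket : ∀ P : Finset V, PocketConn.IsPocket ends (↑P : Set V) a₁ a₂ → a₃ ∈ P → a₁ ∉ P →
    a₂ ∉ P → o ∉ P → b ∈ P
  /-- (SEP-2) -/
  sep2 : b ∈ cluster ends (sepConfig ends {a₁, a₂}) o
  /-- (SEP-3) -/
  sep3 : a₂ ∉ cluster ends (sepConfig ends {a₁, a₃}) o ∪ {a₁, a₃} →
    b ∈ cluster ends (sepConfig ends {a₁, a₃}) o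
  /-- (SEP-3), roots swapped -/
  sep3' : a₁ ∉ cluster ends (sepConfig ends {a₂, a₃}) o ∪ {a₂, a₃} →
    b ∈ cluster ends (sepConfig ends {a₂, a₃}) o
  /-- not a necklace -/
  noNecklace : ∀ (q : Fin 5 → V) (blk : E → Fin 5) (Vj : Fin 5 → Set V),
    Cycle.IsNecklace ends q blk Vj → ∀ ko k₁ k₂ k₃ kb : Fin 5, ko ≠ k₁ → ko ≠ k₂ → ko ≠ k₃ →
    ko ≠ kb → k₁ ≠ k₂ → k₁ ≠ k₃ → k₁ ≠ kb → k₂ ≠ k₃ → k₂ ≠ kb → k₃ ≠ kb →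
    q ko = o → q k₁ = a₁ → q k₂ = a₂ → q k₃ = a₃ → q kb ≠ b
  /-- not the five-terminal block-substitution class -/
  notFive : ¬ BlockSubst.FiveTerminalClass ends o a₁ a₂ a₃ b
  /-- not the six-terminal block-substitution class -/
  notSix : ¬ BlockSubst.SixTerminalClass ends o a₁ a₂ a₃ b
  /-- not a certified seven-skeleton -/
  notSeven : ¬ Seven.SevenSkelClass ends o a₁ a₂ a₃ b
  /-- not a certified seven-skeleton, roots swapped -/
  notSeven' : ¬ Seven.SevenSkelClass ends o a₂ a₁ a₃ b
  /-- `a₁` is not isolated -/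
  notIso_a1 : ¬ IsolatedMark.IsIsolated ends a₁
  /-- `a₂` is not isolated -/
  notIso_a2 : ¬ IsolatedMark.IsIsolated ends a₂
  /-- `o` is not isolated -/
  notIso_o : ¬ IsolatedMark.IsIsolated ends o
  /-- `b` is not isolated -/
  notIso_b : ¬ IsolatedMark.IsIsolated ends b

omit [DecidableEq E] in
/-- `WReducedT` projects onto its minimal clause list. -/
theorem wredMin_of_wredT {ends : E → Sym2 V} {o a₁ a₂ a₃ b : V}
    (h : WReducedT ends o a₁ a₂ a₃ b) : WReducedMin ends o a₁ a₂ a₃ b :=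
  ⟨h.simple, h.noBlock, h.deg_o, h.deg_b, h.deg_a1, h.deg_a2, h.leaf_a3, h.twoThree, h.notR,
    h.notR3, h.noPocket, h.sep2, h.sep3, h.sep3', h.noNecklace, h.notFive, h.notSix, h.notSeven,
    h.notSeven', h.notIso_a1, h.notIso_a2, h.notIso_o, h.notIso_b⟩

/-- The minimal clause list gives back `WReducedT`: the unmarked-degree, pendant-root and
`prune` / `oneFar` clauses follow from the others. -/
theorem wredT_of_wredMin {ends : E → Sym2 V} {o a₁ a₂ a₃ b : V}
    (h : WReducedMin ends o a₁ a₂ a₃ b) : WReducedT ends o a₁ a₂ a₃ b := by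
  have hun : ∀ y, Unmarked o a₁ a₂ a₃ b y → nonLoopDeg ends y ≠ 1 ∧ nonLoopDeg ends y ≠ 2 :=
    fun y hy => ⟨fun h1 => h.noBlock (hasBlock_of_unmarked_leaf hy h1),
      fun h2 => h.noBlock (hasBlock_of_unmarked_series hy h2)⟩
  have hprune : ∀ (side : E → Bool) (L : Set V) (v : V) (Rt : Set V) (g : E),
      CutVertex ends side L v Rt → (∀ m ∈ ({o, a₁, a₂, a₃, b} : Set V), m ∈ Rt ∨ m = v) →
      side g = true → (ends g).IsDiag := by
    intro side L v Rt g hcut hM hg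
    by_contra hd
    exact h.noBlock (hasBlock_of_prune hcut hM hg hd)
  have honeFar : ∀ (side : E → Bool) (L : Set V) (v : V) (Rt : Set V) (w : V),
      CutVertex ends side L v Rt → w ∈ L →
      (∀ m ∈ ({o, a₁, a₂, a₃, b} : Set V), m = w ∨ m ∈ Rt ∨ m = v) → leftCard ends side ≤ 1 := by
    intro side L v Rt w hcut hw hM
    by_contra hlt
    push Not at hlt
    obtain ⟨g₁, hg₁, g₂, hg₂, hne⟩ := Finset.one_lt_card.1 hlt
    rw [Finset.mem_filter] at hg₁ hg₂
    exact h.noBlock (hasBlock_of_oneFar h.simple hcut hw hM hne hg₁.2.1 hg₁.2.2 hg₂.2.1 hg₂.2.2)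
  exact ⟨⟨⟨⟨⟨⟨⟨⟨⟨⟨h.simple, hun, h.deg_o, h.deg_b⟩, h.leaf_a3,
    fun _ _ _ _ h1 => absurd h1 h.deg_a1, fun _ _ _ _ h2 => absurd h2 h.deg_a2⟩,
    hprune, honeFar, h.twoThree⟩, h.notR, h.notR3, h.noPocket, h.sep2, h.sep3, h.sep3'⟩,
    h.noNecklace⟩, h.notFive, h.notSix⟩, h.notSeven, h.notSeven'⟩, h.deg_a1, h.deg_a2⟩,
    h.notIso_a1, h.notIso_a2, h.notIso_o, h.notIso_b⟩, h.noBlock⟩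

/-- **THE RESIDUAL WITH ITS MINIMAL CLAUSE LIST**: `WReducedT ↔ WReducedMin`. -/
theorem wredT_iff_wredMin {ends : E → Sym2 V} {o a₁ a₂ a₃ b : V} :
    WReducedT ends o a₁ a₂ a₃ b ↔ WReducedMin ends o a₁ a₂ a₃ b :=
  ⟨wredMin_of_wredT, wredT_of_wredMin⟩

end ClassMin

end WRed

end Summit.Ventures.PercRepro2
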